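import Summits.CriticalPhenomena.PercolationContinuityZ3.Theorems.PercNearOneGluingNoHeavyLowerTailKnQuestion8CoefficientwiseNCAElim
import HarnessLib

/-!
# NCA follows from NO-CORE for target sets (`X`-elimination iterated) — prim-lf-2 gen 63

Support file (`--supports stmt-CriticalPhenomena-4575`, closed), prover `prim-lf-2` (gen 63).  No definitions, no named facts, no sorries; standard axioms.
Memo `prim-lf-2/CW-NCA-gen63.md` §7.  Uses `nca_of_elim_edge` (`…CoefficientwiseNCAElim.lean`).

For an edge set `E`, root `x`, vertex sets `X, W`, monotone `f, g`:
`NCA_E(x; X, W) = Σ_{s ⊆ E : (∀ v∈X, v ∉ C_x s ∧ v ∉ C_x(E∖s)) ∧ (∀ w∈W, ¬(w ∈ C_x s ∧ w ∈ C_x(E∖s)))} T`,  `NC*_E(x; W) = Σ_{s ⊆ E : ∀ w∈W, ¬(w ∈ C_x s ∧ w ∈ C_x(E∖s))} T`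
(`T = (f(C_x s) − f(C_x(E∖s)))(g(C_x s) − g(C_x(E∖s)))`; `NC*` = NO-CORE for the target SET `W`, `W = {y}`: CONJECTURE NO-CORE of gen 46).
* `Coefficientwise.nca_of_multiTargetNoCore` — if `NC*_{E''}(x; W') ≥ 0` for every `E'' ⊆ E`, every `W'` and all monotone pairs, then `NCA_E(x; X, W) ≥ 0` for all `X, W` and all
  monotone pairs.  (Induction on `|E|`: an edge at a vertex of `X` is eliminated by `nca_of_elim_edge`; when no edge meets `X`, the `X`-condition is vacuous or — if `x ∈ X` — the
  sum is empty.)  Hence CONJECTURE NCA ⟺ 'NO-CORE for target sets' on all sub-multigraphs; with `nca_glue` both reduce to 2-connected multigraphs.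
[cite: KozmaNitzan2024, Questions 8–9 (§5.5 p. 36) (context: the Question-8 pocket covariance programme)]
-/

namespace Summit.CriticalPhenomena.PercolationContinuityZ3.Theorems

open Finset Literature.Probability.Percolation

namespace Coefficientwise

variable {ι V : Type*} [DecidableEq ι]

open Classical in
/-- **NCA from multi-target NO-CORE.**  If for every `E'' ⊆ E` and every vertex set `W'` the NO-CORE sum of `(E'', x)` for the target set `W'` is nonnegative for all monotone
pairs, then every NCA sum of `(E, x)` is nonnegative. [cite: KozmaNitzan2024, Questions 8–9 (§5.5 p. 36) (context)] -/
theorem nca_of_multiTargetNoCore (ends : ι → Sym2 V) (x : V) :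
    ∀ (n : ℕ) (E : Finset ι), E.card ≤ n →
      (∀ E'' : Finset ι, E'' ⊆ E → ∀ (W' : Set V) (φ ψ : Set V → ℝ), Monotone φ → Monotone ψ →
        0 ≤ ∑ s ∈ E''.powerset.filter (fun s : Finset ι =>
              ∀ w ∈ W', ¬ (w ∈ openCluster (ends '' (↑s : Set ι)) x ∧ w ∈ openCluster (ends '' (↑(E'' \ s) : Set ι)) x)),
          (φ (openCluster (ends '' (↑s : Set ι)) x) - φ (openCluster (ends '' (↑(E'' \ s) : Set ι)) x)) *
            (ψ (openCluster (ends '' (↑s : Set ι)) x) - ψ (openCluster (ends '' (↑(E'' \ s) : Set ι)) x))) →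
      ∀ (X W : Set V) (f g : Set V → ℝ), Monotone f → Monotone g →
        0 ≤ ∑ s ∈ E.powerset.filter (fun s : Finset ι =>
              (∀ v ∈ X, v ∉ openCluster (ends '' (↑s : Set ι)) x ∧ v ∉ openCluster (ends '' (↑(E \ s) : Set ι)) x) ∧
              (∀ w ∈ W, ¬ (w ∈ openCluster (ends '' (↑s : Set ι)) x ∧ w ∈ openCluster (ends '' (↑(E \ s) : Set ι)) x))),
          (f (openCluster (ends '' (↑s : Set ι)) x) - f (openCluster (ends '' (↑(E \ s) : Set ι)) x)) *
            (g (openCluster (ends '' (↑s : Set ι)) x) - g (openCluster (ends '' (↑(E \ s) : Set ι)) x)) := by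
  intro n
  induction n with
  | zero =>
    intro E hE hNC X W f g hf hg
    have hE0 : E = ∅ := Finset.card_eq_zero.mp (Nat.le_zero.mp hE)
    subst hE0
    -- a single colouring `s = ∅`; both clusters coincide, the summand vanishes
    rw [Finset.sum_filter]
    refine Finset.sum_nonneg fun s hs => ?_
    have hs0 : s = ∅ := Finset.subset_empty.mp (Finset.mem_powerset.mp hs)
    subst hs0
    split_ifs
    · simp
    · exact le_refl _
  | succ n ih =>
    intro E hE hNC X W f g hf hg
    by_cases hedge : ∃ e ∈ E, ∃ c ∈ X, c ∈ ends e
    · -- eliminate an edge at a vertex of `X`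
      obtain ⟨e, heE, c, hcX, hce⟩ := hedge
      obtain ⟨v, hv⟩ : ∃ v, ends e = s(c, v) := ⟨Sym2.Mem.other hce, (Sym2.other_spec hce).symm⟩
      have hEe : E = insert e (E.erase e) := (Finset.insert_erase heE).symm
      have hcard : (E.erase e).card ≤ n := by
        have := Finset.card_erase_of_mem heE; omega
      have hNC' : ∀ E'' : Finset ι, E'' ⊆ E.erase e → ∀ (W' : Set V) (φ ψ : Set V → ℝ), Monotone φ → Monotone ψ →
          0 ≤ ∑ s ∈ E''.powerset.filter (fun s : Finset ι =>
              ∀ w ∈ W', ¬ (w ∈ openCluster (ends '' (↑s : Set ι)) x ∧ w ∈ openCluster (ends '' (↑(E'' \ s) : Set ι)) x)),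
            (φ (openCluster (ends '' (↑s : Set ι)) x) - φ (openCluster (ends '' (↑(E'' \ s) : Set ι)) x)) *
              (ψ (openCluster (ends '' (↑s : Set ι)) x) - ψ (openCluster (ends '' (↑(E'' \ s) : Set ι)) x)) :=
        fun E'' hE'' => hNC E'' (hE''.trans (Finset.erase_subset e E))
      rw [hEe]
      exact nca_of_elim_edge ends (Finset.notMem_erase e E) hv X W hcX f g
        (ih (E.erase e) hcard hNC' (insert v X) W f g hf hg) (ih (E.erase e) hcard hNC' X (insert v W) f g hf hg)
    · push Not at hedge
      by_cases hxX : x ∈ X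
      · -- `x ∈ X`: the event is empty
        rw [Finset.sum_filter]
        refine Finset.sum_nonneg fun s _ => ?_
        rw [if_neg (fun h => (h.1 x hxX).1 (mem_openCluster_self _ x))]
      · -- no edge meets `X`: the `X`-condition is vacuous
        have hvac : ∀ s ∈ E.powerset,
            ((∀ v ∈ X, v ∉ openCluster (ends '' (↑s : Set ι)) x ∧ v ∉ openCluster (ends '' (↑(E \ s) : Set ι)) x) ∧
              (∀ w ∈ W, ¬ (w ∈ openCluster (ends '' (↑s : Set ι)) x ∧ w ∈ openCluster (ends '' (↑(E \ s) : Set ι)) x))) ↔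
            (∀ w ∈ W, ¬ (w ∈ openCluster (ends '' (↑s : Set ι)) x ∧ w ∈ openCluster (ends '' (↑(E \ s) : Set ι)) x)) := by
          intro s hs
          have hsE := Finset.mem_powerset.mp hs
          constructor
          · exact fun h => h.2
          · intro h
            refine ⟨fun v hv => ?_, h⟩
            have hvx : v ≠ x := fun h' => hxX (h' ▸ hv)
            exact ⟨not_mem_openCluster_of_forall_not_mem ends (fun e' he' hve' => hedge e' (hsE he') v hv hve') hvx,
              not_mem_openCluster_of_forall_not_mem ends (fun e' he' hve' => hedge e' (Finset.sdiff_subset he') v hv hve') hvx⟩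
        rw [Finset.filter_congr hvac]
        exact hNC E (subset_refl E) W f g hf hg

end Coefficientwise

end Summit.CriticalPhenomena.PercolationContinuityZ3.Theorems
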